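import Mathlib

/-!
# Hodge-locus census, cell (8,4,3) — the SM-2 member: closed forms of its ten partial derivatives

certified instances and evidence bearing on the general Hodge conjecture; no claim.

ENGINE B gen 34 (record `ENGINEB-g34.md` §1).  The member is
`F = y0 (x0^3 - x1^2 x2) + y1 (x1^3 - x2^2 x3) + y2 (x2^3 - x0 x3^2) + y3 x3^3 + y0^4 + y1^4 + y2^4 + y3^4
     + a b (x0 x1 + a^2 + b^2)`.
For each variable `v` we regard `F` as a one-variable polynomial in `v` (Mathlib's `Polynomial.X`) whose other nine
variables are arbitrary constants of a commutative ring `R`, and check that `Polynomial.derivative` equals the closed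
form used in the hand steps (H1)/(H2) of the record (and assumed as hypotheses by `case_split`, `caseIV_grad_x0`,
`caseIV_grad_x1` of `HodgeLocusCensusSigmaMember.lean`):
`E_a = b (g + 3 a^2 + b^2)`, `E_b = a (g + a^2 + 3 b^2)` with `g = x0 x1`, the four `x`-partials and the four
`y`-partials `h_j + 4 y_j^3`.  Def-free; `import Mathlib` only.
-/

namespace Summit.HodgeConjecture.HodgeConjecture.HodgeLocus.Census.SigmaMemberPartials

open Polynomial

variable {R : Type*} [CommRing R]

/-- `∂F/∂a = b (x0 x1 + 3 a^2 + b^2)`: `F` as a polynomial in `a`. -/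
theorem partial_a (b x0 x1 x2 x3 y0 y1 y2 y3 : R) :
    derivative (C (y0 * (x0 ^ 3 - x1 ^ 2 * x2) + y1 * (x1 ^ 3 - x2 ^ 2 * x3) + y2 * (x2 ^ 3 - x0 * x3 ^ 2)
        + y3 * x3 ^ 3 + y0 ^ 4 + y1 ^ 4 + y2 ^ 4 + y3 ^ 4)
      + X * C b * (C (x0 * x1) + X ^ 2 + C (b ^ 2)))
    = C b * (C (x0 * x1) + 3 * X ^ 2 + C (b ^ 2)) := by
  simp only [derivative_add, derivative_mul, derivative_C, derivative_X, derivative_X_pow, Nat.cast_ofNat, map_ofNat]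
  ring

/-- `∂F/∂b = a (x0 x1 + a^2 + 3 b^2)`: `F` as a polynomial in `b`. -/
theorem partial_b (a x0 x1 x2 x3 y0 y1 y2 y3 : R) :
    derivative (C (y0 * (x0 ^ 3 - x1 ^ 2 * x2) + y1 * (x1 ^ 3 - x2 ^ 2 * x3) + y2 * (x2 ^ 3 - x0 * x3 ^ 2)
        + y3 * x3 ^ 3 + y0 ^ 4 + y1 ^ 4 + y2 ^ 4 + y3 ^ 4)
      + C a * X * (C (x0 * x1) + C (a ^ 2) + X ^ 2))
    = C a * (C (x0 * x1) + C (a ^ 2) + 3 * X ^ 2) := by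
  simp only [derivative_add, derivative_mul, derivative_C, derivative_X, derivative_X_pow, Nat.cast_ofNat, map_ofNat]
  ring

/-- `∂F/∂x0 = 3 y0 x0^2 - y2 x3^2 + a b x1`: `F` as a polynomial in `x0`. -/
theorem partial_x0 (a b x1 x2 x3 y0 y1 y2 y3 : R) :
    derivative (C y0 * (X ^ 3 - C (x1 ^ 2 * x2)) + C (y1 * (x1 ^ 3 - x2 ^ 2 * x3)) + C y2 * (C (x2 ^ 3) - X * C (x3 ^ 2))
        + C (y3 * x3 ^ 3 + y0 ^ 4 + y1 ^ 4 + y2 ^ 4 + y3 ^ 4)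
      + C (a * b) * (X * C x1 + C (a ^ 2 + b ^ 2)))
    = 3 * C y0 * X ^ 2 - C (y2 * x3 ^ 2) + C (a * b * x1) := by
  simp only [derivative_sub, derivative_mul, derivative_C, derivative_X, derivative_X_pow, map_mul,
    map_add, Nat.cast_ofNat, map_ofNat]
  ring

/-- `∂F/∂x1 = -2 y0 x2 x1 + 3 y1 x1^2 + a b x0`: `F` as a polynomial in `x1`. -/
theorem partial_x1 (a b x0 x2 x3 y0 y1 y2 y3 : R) :
    derivative (C y0 * (C (x0 ^ 3) - X ^ 2 * C x2) + C y1 * (X ^ 3 - C (x2 ^ 2 * x3)) + C (y2 * (x2 ^ 3 - x0 * x3 ^ 2))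
        + C (y3 * x3 ^ 3 + y0 ^ 4 + y1 ^ 4 + y2 ^ 4 + y3 ^ 4)
      + C (a * b) * (C x0 * X + C (a ^ 2 + b ^ 2)))
    = -(2 * C (y0 * x2) * X) + 3 * C y1 * X ^ 2 + C (a * b * x0) := by
  simp only [derivative_sub, derivative_mul, derivative_C, derivative_X, derivative_X_pow, map_mul,
    map_add, Nat.cast_ofNat, map_ofNat]
  ring

/-- `∂F/∂x2 = -y0 x1^2 - 2 y1 x3 x2 + 3 y2 x2^2`: `F` as a polynomial in `x2`. -/
theorem partial_x2 (a b x0 x1 x3 y0 y1 y2 y3 : R) :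
    derivative (C y0 * (C (x0 ^ 3) - C (x1 ^ 2) * X) + C y1 * (C (x1 ^ 3) - X ^ 2 * C x3) + C y2 * (X ^ 3 - C (x0 * x3 ^ 2))
        + C (y3 * x3 ^ 3 + y0 ^ 4 + y1 ^ 4 + y2 ^ 4 + y3 ^ 4)
      + C (a * b * (x0 * x1 + a ^ 2 + b ^ 2)))
    = -C (y0 * x1 ^ 2) - 2 * C (y1 * x3) * X + 3 * C y2 * X ^ 2 := by
  simp only [derivative_sub, derivative_mul, derivative_C, derivative_X, derivative_X_pow, map_mul,
    map_add, Nat.cast_ofNat, map_ofNat]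
  ring

/-- `∂F/∂x3 = -y1 x2^2 - 2 y2 x0 x3 + 3 y3 x3^2`: `F` as a polynomial in `x3`. -/
theorem partial_x3 (a b x0 x1 x2 y0 y1 y2 y3 : R) :
    derivative (C (y0 * (x0 ^ 3 - x1 ^ 2 * x2)) + C y1 * (C (x1 ^ 3) - C (x2 ^ 2) * X) + C y2 * (C (x2 ^ 3) - C x0 * X ^ 2)
        + C y3 * X ^ 3 + C (y0 ^ 4 + y1 ^ 4 + y2 ^ 4 + y3 ^ 4)
      + C (a * b * (x0 * x1 + a ^ 2 + b ^ 2)))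
    = -C (y1 * x2 ^ 2) - 2 * C (y2 * x0) * X + 3 * C y3 * X ^ 2 := by
  simp only [derivative_sub, derivative_mul, derivative_C, derivative_X, derivative_X_pow, map_mul,
    map_add, Nat.cast_ofNat, map_ofNat]
  ring

/-- `∂F/∂y0 = h0 + 4 y0^3`: `F` as a polynomial in `y0`. -/
theorem partial_y0 (a b x0 x1 x2 x3 y1 y2 y3 : R) :
    derivative (X * C (x0 ^ 3 - x1 ^ 2 * x2) + C (y1 * (x1 ^ 3 - x2 ^ 2 * x3) + y2 * (x2 ^ 3 - x0 * x3 ^ 2) + y3 * x3 ^ 3)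
        + X ^ 4 + C (y1 ^ 4 + y2 ^ 4 + y3 ^ 4) + C (a * b * (x0 * x1 + a ^ 2 + b ^ 2)))
    = C (x0 ^ 3 - x1 ^ 2 * x2) + 4 * X ^ 3 := by
  simp only [derivative_add, derivative_mul, derivative_C, derivative_X, derivative_X_pow, Nat.cast_ofNat, map_ofNat]
  ring

/-- `∂F/∂y1 = h1 + 4 y1^3`. -/
theorem partial_y1 (a b x0 x1 x2 x3 y0 y2 y3 : R) :
    derivative (C (y0 * (x0 ^ 3 - x1 ^ 2 * x2)) + X * C (x1 ^ 3 - x2 ^ 2 * x3) + C (y2 * (x2 ^ 3 - x0 * x3 ^ 2) + y3 * x3 ^ 3)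
        + C (y0 ^ 4) + X ^ 4 + C (y2 ^ 4 + y3 ^ 4) + C (a * b * (x0 * x1 + a ^ 2 + b ^ 2)))
    = C (x1 ^ 3 - x2 ^ 2 * x3) + 4 * X ^ 3 := by
  simp only [derivative_add, derivative_mul, derivative_C, derivative_X, derivative_X_pow, Nat.cast_ofNat, map_ofNat]
  ring

/-- `∂F/∂y2 = h2 + 4 y2^3`. -/
theorem partial_y2 (a b x0 x1 x2 x3 y0 y1 y3 : R) :
    derivative (C (y0 * (x0 ^ 3 - x1 ^ 2 * x2) + y1 * (x1 ^ 3 - x2 ^ 2 * x3)) + X * C (x2 ^ 3 - x0 * x3 ^ 2) + C (y3 * x3 ^ 3)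
        + C (y0 ^ 4 + y1 ^ 4) + X ^ 4 + C (y3 ^ 4) + C (a * b * (x0 * x1 + a ^ 2 + b ^ 2)))
    = C (x2 ^ 3 - x0 * x3 ^ 2) + 4 * X ^ 3 := by
  simp only [derivative_add, derivative_mul, derivative_C, derivative_X, derivative_X_pow, Nat.cast_ofNat, map_ofNat]
  ring

/-- `∂F/∂y3 = h3 + 4 y3^3` with `h3 = x3^3`. -/
theorem partial_y3 (a b x0 x1 x2 x3 y0 y1 y2 : R) :
    derivative (C (y0 * (x0 ^ 3 - x1 ^ 2 * x2) + y1 * (x1 ^ 3 - x2 ^ 2 * x3) + y2 * (x2 ^ 3 - x0 * x3 ^ 2)) + X * C (x3 ^ 3)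
        + C (y0 ^ 4 + y1 ^ 4 + y2 ^ 4) + X ^ 4 + C (a * b * (x0 * x1 + a ^ 2 + b ^ 2)))
    = C (x3 ^ 3) + 4 * X ^ 3 := by
  simp only [derivative_add, derivative_mul, derivative_C, derivative_X, derivative_X_pow, Nat.cast_ofNat, map_ofNat]
  ring


/-- The extra term of the cones `Φ_c = G + c·x0²x1²`: `∂(c x0² x1²)/∂x0 = 2c x0 x1²` (as a polynomial in `x0`), so that
`∂Φ_c/∂x0 = 3 x0² y0 − x3² y2 + 2c x0 x1²` = hypothesis `P0` of `cone_x3_zero`. -/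
theorem cone_term_partial_x0 (c x1 : R) :
    derivative (C c * X ^ 2 * C (x1 ^ 2)) = 2 * C c * X * C (x1 ^ 2) := by
  simp only [derivative_mul, derivative_C, derivative_X_pow, Nat.cast_ofNat, map_ofNat]
  ring

/-- `∂(c x0² x1²)/∂x1 = 2c x0² x1` (as a polynomial in `x1`) = the extra term of hypothesis `P1` of `cone_x3_zero`. -/
theorem cone_term_partial_x1 (c x0 : R) :
    derivative (C c * C (x0 ^ 2) * X ^ 2) = 2 * C c * C (x0 ^ 2) * X := by
  simp only [derivative_mul, derivative_C, derivative_X_pow, Nat.cast_ofNat, map_ofNat]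
  ring

/-- Euler's identity for the quartic `F` (degree 4): `a E_a + b E_b + Σ x_i E_{x_i} + Σ y_j E_{y_j} = 4 F`, with the
closed forms above — the consistency check both implementations also run ('euler_identity' = true). -/
theorem euler_identity (a b x0 x1 x2 x3 y0 y1 y2 y3 : R) :
    a * (b * (x0 * x1 + 3 * a ^ 2 + b ^ 2)) + b * (a * (x0 * x1 + a ^ 2 + 3 * b ^ 2))
      + x0 * (3 * y0 * x0 ^ 2 - y2 * x3 ^ 2 + a * b * x1) + x1 * (-(2 * y0 * x2 * x1) + 3 * y1 * x1 ^ 2 + a * b * x0)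
      + x2 * (-(y0 * x1 ^ 2) - 2 * y1 * x3 * x2 + 3 * y2 * x2 ^ 2) + x3 * (-(y1 * x2 ^ 2) - 2 * y2 * x0 * x3 + 3 * y3 * x3 ^ 2)
      + y0 * (x0 ^ 3 - x1 ^ 2 * x2 + 4 * y0 ^ 3) + y1 * (x1 ^ 3 - x2 ^ 2 * x3 + 4 * y1 ^ 3)
      + y2 * (x2 ^ 3 - x0 * x3 ^ 2 + 4 * y2 ^ 3) + y3 * (x3 ^ 3 + 4 * y3 ^ 3)
    = 4 * (y0 * (x0 ^ 3 - x1 ^ 2 * x2) + y1 * (x1 ^ 3 - x2 ^ 2 * x3) + y2 * (x2 ^ 3 - x0 * x3 ^ 2) + y3 * x3 ^ 3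
        + y0 ^ 4 + y1 ^ 4 + y2 ^ 4 + y3 ^ 4 + a * b * (x0 * x1 + a ^ 2 + b ^ 2)) := by
  ring

/-- `h` is a complete intersection: `V(h) = ∅` in `ℙ³` over a field (the chain `x3 = 0 ⇒ x2 = 0 ⇒ x1 = 0 ⇒ x0 = 0`
of CLAIM SM-2 (ii)). -/
theorem h_ci {K : Type*} [Field K] (x0 x1 x2 x3 : K) (h3 : x3 ^ 3 = 0) (h2 : x2 ^ 3 - x0 * x3 ^ 2 = 0)
    (h1 : x1 ^ 3 - x2 ^ 2 * x3 = 0) (h0 : x0 ^ 3 - x1 ^ 2 * x2 = 0) :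
    x0 = 0 ∧ x1 = 0 ∧ x2 = 0 ∧ x3 = 0 := by
  have e3 : x3 = 0 := pow_eq_zero_iff (n := 3) (by norm_num) |>.mp h3
  subst e3
  have e2 : x2 = 0 := by
    have : x2 ^ 3 = 0 := by simpa using h2
    exact pow_eq_zero_iff (n := 3) (by norm_num) |>.mp this
  subst e2
  have e1 : x1 = 0 := by
    have : x1 ^ 3 = 0 := by simpa using h1
    exact pow_eq_zero_iff (n := 3) (by norm_num) |>.mp this
  subst e1
  have e0 : x0 = 0 := by
    have : x0 ^ 3 = 0 := by simpa using h0
    exact pow_eq_zero_iff (n := 3) (by norm_num) |>.mp this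
  exact ⟨e0, rfl, rfl, rfl⟩

/-- Case (II) of the case split is empty given CONE0's conclusion: if `∇G = 0` forces `x0 = 0` (indeed `(x, y) = 0`),
then the remaining equation `E_a = g + 1 = x0 x1 + 1 = 0` of the chart `a = 0, b = 1` cannot hold. -/
theorem caseII_empty {K : Type*} [Field K] (x0 x1 : K) (hx0 : x0 = 0) (hEa : x0 * x1 + 1 = 0) : False := by
  subst hx0; simp at hEa

end Summit.HodgeConjecture.HodgeConjecture.HodgeLocus.Census.SigmaMemberPartials
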